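import Literature.MathematicalPhysics.KineticTheory.HardSphereEulerPrimitiveForm
import Literature.MathematicalPhysics.KineticTheory.HardSphereEulerLocalTheoryReduction
import Literature.MathematicalPhysics.KineticTheory.HardSphereEulerSolutionGluing
import Summits.AtomisticToContinuum.HydrodynamicLimit.Theorems.ImplosionDichotomyHsEosLowDensity
import Summits.AtomisticToContinuum.HydrodynamicLimit.Theorems.RelayRaceLocalityRestartPrincipleStubSolutionShift
import HarnessLib

/-!
# RelayRaceLocality · ConeLocalisation — bubble stub, helper (PC0): σ-uniform read-outs of the
# primitive hard-sphere Euler equations (time-derivative and drift bounds)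

Helper file for the lead-held stub `stub_bubble : BubbleAtScale` of the line `Sketch`
(zoomed-bubble-transplant) of the crux item `stmt-AtomisticToContinuum-12504` (`ConeLocalisation`,
route RelayRaceLocality of `AtomisticToContinuum/HydrodynamicLimit`), lead
prover-line-stmt-AtomisticToContinuum-12504-0 (2026-08-17).

Setting: a classical solution `IsHardSphereEulerSolution σ T ρ u θ` of the compressible Euler
system of the hard-sphere gas on `[0, T) × 𝕋³` (pressure `p = hsPressure σ ρ θ = ρ θ Z(ρσ³)`,
`Z = hsCompressibility`), and the analytic low-density equation of state
(`Theorems.hsEosLowDensity_proof` + `exists_contDiff_eqOn_hsCompressibility`: a globally smooth `Z`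
agreeing with `hsCompressibility` on the packing band `[0, η₀/2]`).

* `primitive_of_packing_at` — the momentum and temperature equations in PRIMITIVE form at a time
  `t` at which the packing is `≤ η₀/4` everywhere (the tree's
  `IsHardSphereEulerSolution.density_mul_timeDeriv_velocity_eq` / `timeDeriv_temperature_eq` ask
  for the smooth pressure law along the whole horizon; here it is fed the solution SHIFTED to `t`
  (`RestartPrinciple.stub_solutionShift`) and RESTRICTED (`IsHardSphereEulerSolution.restrict`) to a
  short window `[t, t + ε)` on which the packing stays `< η₀/2` by uniform-in-space continuity in
  time (`Torus.IsSmoothSpaceTimeOn.eventually_norm_sub_lt`), the one-sided time derivatives at the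
  left end of the window being the original ones (chain rule for `s ↦ t + s`)).
* `hsEuler_timeDeriv_drift_bounds` — (T1) σ-UNIFORM TIME-DERIVATIVE BOUNDS, LINEAR IN THE `C¹`
  SIZE: a threshold `ηT > 0` and constants `CT(M)` such that at every `(t, x)` with packing `≤ ηT`
  (everywhere at time `t`), `M⁻¹ ≤ ρ ≤ M`, `θ ≤ M`, `‖u‖ ≤ M` and first spatial derivatives `≤ A`
  at `x`:
  `|∂ₜρ|, ‖∂ₜu‖, |∂ₜθ| ≤ CT(M) · A` (each term of the primitive equations carries exactly one first
  derivative, with a coefficient bounded by `M` and `sup_{[0, ηT]} (|Z| + |Z'|)`); (T2) DRIFT: under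
  these hypotheses on a slab `[0, t) × 𝕋³`,
  `|ρ(t) - ρ(0)|, ‖u(t) - u(0)‖, |θ(t) - θ(0)| ≤ CT · A · t` (mean value inequality,
  `norm_sub_le_of_timeDerivWithin_le`).

The derivative-only Sobolev read-out (T3) is in the sibling `…BubbleReadoutsSobolev.lean`.

Reference: A. Majda, *Compressible Fluid Flow and Systems of Conservation Laws in Several Space
Variables* (1984), Ch. 2, proof of Thm 2.2 / Cor. 2 (reading `‖∂ₜU‖_{L^∞}` off the equations).
-/

noncomputable section

namespace Summit.AtomisticToContinuum.HydrodynamicLimit.Theorems.ConeLocalisation.Bubble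

open scoped Topology ContDiff
open Set Filter MeasureTheory
open Literature.MathematicalPhysics.KineticTheory Literature.Analysis.FluidPDE
  Literature.Analysis.FunctionSpaces
open Summit.AtomisticToContinuum.HydrodynamicLimit.Theorems

/-- **The primitive momentum and temperature equations at a time of small packing.** Let `Z` be
smooth with `hsCompressibility = Z` on `[0, η₀/2]`, and let `(ρ, u, θ)` be a classical hard-sphere
Euler solution at reduced diameter `σ > 0` on `[0, T)`. At every time `t ∈ [0, T)` at which the
packing `ρσ³` is `≤ η₀/4` everywhere, for every `x` and `j`:
`ρ ∂ₜuⱼ = -ρ Σᵢ uᵢ ∂ᵢuⱼ - (θ (Z(η) + η Z'(η)) ∂ⱼρ + ρ Z(η) ∂ⱼθ)` and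
`∂ₜθ = -Σᵢ uᵢ ∂ᵢθ - (2/3) θ Z(η) Σᵢ ∂ᵢuᵢ`, `η = ρσ³` (all at `(t, x)`; `∂ₜ` = one-sided time
derivative within `[0, T)`). Obtained from the tree's primitive form along the solution shifted
to `t` and restricted to a short window on which the packing stays in the band. [folklore] -/
theorem primitive_of_packing_at {η₀ : ℝ} (hη₀ : 0 < η₀) {Z : ℝ → ℝ} (hZ : ContDiff ℝ ∞ Z)
    (hZeq : EqOn hsCompressibility Z (Icc 0 (η₀ / 2)))
    {σ T : ℝ} (hσ : 0 < σ) {ρ θ : ℝ → T3 → ℝ} {u : ℝ → T3 → V3}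
    (hE : IsHardSphereEulerSolution σ T ρ u θ) {t : ℝ} (ht : t ∈ Ico 0 T)
    (hpack : ∀ y, ρ t y * σ ^ 3 ≤ η₀ / 4) (x : T3) :
    (∀ j : Fin 3, ρ t x * Torus.timeDerivWithin (Ico 0 T) (fun s y => u s y j) t x =
      -(ρ t x * ∑ i, u t x i * Torus.partialDeriv i (fun y => u t y j) x) -
        (θ t x * (Z (ρ t x * σ ^ 3) + ρ t x * σ ^ 3 * deriv Z (ρ t x * σ ^ 3)) *
            Torus.partialDeriv j (ρ t) x +
          ρ t x * Z (ρ t x * σ ^ 3) * Torus.partialDeriv j (θ t) x)) ∧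
    Torus.timeDerivWithin (Ico 0 T) θ t x =
      -(∑ i, u t x i * Torus.partialDeriv i (θ t) x) -
        2 / 3 * (θ t x * Z (ρ t x * σ ^ 3)) * ∑ i, Torus.partialDeriv i (fun y => u t y i) x := by
  have hσ3 : (0 : ℝ) < σ ^ 3 := pow_pos hσ 3
  -- (1) uniform continuity in time of the density: a window `[t, t + ε)` of packing `< η₀/2`
  have hδ : (0 : ℝ) < η₀ / 4 / σ ^ 3 := by positivity
  have hev := hE.smooth_density.eventually_norm_sub_lt ht hδ
  rw [eventually_nhdsWithin_iff, Metric.eventually_nhds_iff] at hev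
  obtain ⟨ε, hε, hεP⟩ := hev
  set T' : ℝ := min (T - t) ε with hT'
  have hT'pos : 0 < T' := lt_min (by linarith [ht.2]) hε
  -- (2) the shifted solution on `[0, T - t)`, restricted to `[0, T')`
  have hS : IsHardSphereEulerSolution σ T' (fun s => ρ (t + s)) (fun s => u (t + s))
      (fun s => θ (t + s)) :=
    (RestartPrinciple.stub_solutionShift σ T ρ θ u hE t ht.1).restrict (min_le_left _ _)
  have hmem : ∀ s ∈ Ico (0 : ℝ) T', t + s ∈ Ico 0 T := fun s hs =>
    ⟨by linarith [ht.1, hs.1], by linarith [hs.2, min_le_left (T - t) ε]⟩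
  have hpackS : ∀ s ∈ Ico (0 : ℝ) T', ∀ y, ρ (t + s) y * σ ^ 3 ∈ Icc 0 (η₀ / 2) := by
    intro s hs y
    refine ⟨(mul_pos (hE.density_pos _ (hmem s hs) y) hσ3).le, ?_⟩
    have hd : dist (t + s) t < ε := by
      rw [Real.dist_eq, add_sub_cancel_left, abs_of_nonneg hs.1]
      exact hs.2.trans_le (min_le_right _ _)
    have h1 : ‖ρ (t + s) y - ρ t y‖ < η₀ / 4 / σ ^ 3 := hεP hd (hmem s hs) y
    rw [Real.norm_eq_abs] at h1
    have h2 : ρ (t + s) y - ρ t y < η₀ / 4 / σ ^ 3 := (le_abs_self _).trans_lt h1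
    have h3 : (ρ (t + s) y - ρ t y) * σ ^ 3 < η₀ / 4 := by
      rwa [lt_div_iff₀ hσ3] at h2
    nlinarith [hpack y]
  -- (3) the pressure law along the window is `ρ θ Z(ρσ³)` with `Z` globally smooth
  have hζ : ContDiffOn ℝ ∞ (fun r => Z (r * σ ^ 3)) univ :=
    (hZ.comp (contDiff_id.mul contDiff_const)).contDiffOn
  have hρJ : ∀ s ∈ Ico (0 : ℝ) T', ∀ y, (fun s => ρ (t + s)) s y ∈ (univ : Set ℝ) :=
    fun _ _ _ => mem_univ _
  have hp : ∀ s ∈ Ico (0 : ℝ) T', ∀ y,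
      hsPressure σ ((fun s => ρ (t + s)) s y) ((fun s => θ (t + s)) s y) =
        (fun s => ρ (t + s)) s y * (fun s => θ (t + s)) s y *
          (fun r => Z (r * σ ^ 3)) ((fun s => ρ (t + s)) s y) := by
    intro s hs y
    show ρ (t + s) y * θ (t + s) y * hsCompressibility (ρ (t + s) y * σ ^ 3) =
      ρ (t + s) y * θ (t + s) y * Z (ρ (t + s) y * σ ^ 3)
    rw [hZeq (hpackS s hs y)]
  have h0 : (0 : ℝ) ∈ Ico 0 T' := ⟨le_rfl, hT'pos⟩
  -- (4) chain rule for `ζ = Z(· σ³)` and the dictionary of time derivatives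
  have hderiv : deriv (fun r => Z (r * σ ^ 3)) (ρ t x) = σ ^ 3 * deriv Z (ρ t x * σ ^ 3) := by
    have h : HasDerivAt (fun r => Z (r * σ ^ 3)) (deriv Z (ρ t x * σ ^ 3) * (1 * σ ^ 3)) (ρ t x) :=
      (hZ.differentiable (by simp)).differentiableAt.hasDerivAt.comp (ρ t x)
        ((hasDerivAt_id (ρ t x)).mul_const (σ ^ 3))
    rw [h.deriv]; ring
  have hU : UniqueDiffOn ℝ (Ico (0 : ℝ) T') := uniqueDiffOn_Ico 0 T'
  have hmaps : MapsTo (fun s : ℝ => t + s) (Ico 0 T') (Ico 0 T) := fun s hs => hmem s hs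
  have hin : HasDerivWithinAt (fun s : ℝ => t + s) 1 (Ico 0 T') 0 :=
    ((hasDerivAt_id (0 : ℝ)).const_add t).hasDerivWithinAt
  have ht0 : t + 0 ∈ Ico 0 T := by simpa using ht
  have hTu : ∀ j : Fin 3, Torus.timeDerivWithin (Ico 0 T') (fun s y => u (t + s) y j) 0 x =
      Torus.timeDerivWithin (Ico 0 T) (fun s y => u s y j) t x := by
    intro j
    have h1 := ((hE.smooth_velocity.apply j).hasDerivWithinAt_slice ht0 x).comp (0 : ℝ) hin hmaps
    have h2 := h1.derivWithin (hU 0 h0)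
    simp only [add_zero, mul_one] at h2
    exact h2
  have hTθ : Torus.timeDerivWithin (Ico 0 T') (fun s y => θ (t + s) y) 0 x =
      Torus.timeDerivWithin (Ico 0 T) θ t x := by
    have h1 := (hE.smooth_temperature.hasDerivWithinAt_slice ht0 x).comp (0 : ℝ) hin hmaps
    have h2 := h1.derivWithin (hU 0 h0)
    simp only [add_zero, mul_one] at h2
    exact h2
  refine ⟨fun j => ?_, ?_⟩
  · have h := hS.density_mul_timeDeriv_velocity_eq isOpen_univ hζ hρJ hp h0 x j
    simp only [add_zero] at h
    rw [hTu j, hderiv] at h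
    rw [h]; ring
  · have h := hS.timeDeriv_temperature_eq isOpen_univ hζ hρJ hp h0 x
    simp only [add_zero] at h
    rw [hTθ] at h
    exact h


/-- Components are bounded by the Euclidean norm. [folklore] -/
-- adapted from `Literature.Analysis.FluidPDE.CompressibleEuler.abs_apply_le_norm`
private theorem abs_apply_le_norm' (v : V3) (i : Fin 3) : |v i| ≤ ‖v‖ := by
  simpa using PiLp.norm_apply_le v i

/-- The Euclidean norm on `ℝ³` is at most the `ℓ¹` norm of the components. [folklore] -/
-- adapted from `Literature.Analysis.FluidPDE.CompressibleEuler.norm_le_sum_abs`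
private theorem norm_le_sum_abs' (v : V3) : ‖v‖ ≤ ∑ i, |v i| := by
  rw [EuclideanSpace.norm_eq, Real.sqrt_le_left (Finset.sum_nonneg fun i _ => abs_nonneg _)]
  simp only [Real.norm_eq_abs, Fin.sum_univ_three]
  nlinarith [abs_nonneg (v 0), abs_nonneg (v 1), abs_nonneg (v 2), sq_abs (v 0), sq_abs (v 1),
    sq_abs (v 2)]

/-- `Σ_{i : Fin 3} c = 3 c`. [folklore] -/
private theorem sum_const_fin_three (c : ℝ) : ∑ _i : Fin 3, c = 3 * c := by
  simp only [Finset.sum_const, Finset.card_univ, Fintype.card_fin, nsmul_eq_mul, Nat.cast_ofNat]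

/-- Read-out of the mass equation `∂ₜρ = -Σᵢ (ρ ∂ᵢuᵢ + ∂ᵢρ uᵢ)`: `|∂ₜρ| ≤ 6 M A`. [folklore] -/
private theorem density_readout {ρ M A X : ℝ} {u du dρ : Fin 3 → ℝ}
    (hX : X = -∑ i, (ρ * du i + dρ i * u i)) (hρpos : 0 < ρ) (hρhi : ρ ≤ M) (hM : 0 < M)
    (hu : ∀ i, |u i| ≤ M) (hdu : ∀ i, |du i| ≤ A) (hdρ : ∀ i, |dρ i| ≤ A) (hA : 0 ≤ A) :
    |X| ≤ 6 * M * A := by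
  rw [hX, abs_neg]
  refine (Finset.abs_sum_le_sum_abs _ _).trans ?_
  calc ∑ i, |ρ * du i + dρ i * u i| ≤ ∑ _i : Fin 3, (M * A + A * M) :=
        Finset.sum_le_sum fun i _ => by
          refine (abs_add_le _ _).trans (add_le_add ?_ ?_)
          · rw [abs_mul, abs_of_pos hρpos]; exact mul_le_mul hρhi (hdu i) (abs_nonneg _) hM.le
          · rw [abs_mul]; exact mul_le_mul (hdρ i) (hu i) (abs_nonneg _) hA
    _ = 6 * M * A := by rw [sum_const_fin_three]; ring

/-- Read-out of one coordinate of the momentum equation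
`ρ ∂ₜuⱼ = -ρ Σᵢ uᵢ ∂ᵢuⱼ - (θ (Z + η Z') ∂ⱼρ + ρ Z ∂ⱼθ)`:
`|∂ₜuⱼ| ≤ (3M + M² C_Z (1 + η_T) + C_Z) A` (uses `1 ≤ ρ M`). [folklore] -/
private theorem velocity_coord_readout {ρ θ Zη Z'η η dρ dθ X M CZ ηT A : ℝ} {u duj : Fin 3 → ℝ}
    (hX : ρ * X = -(ρ * ∑ i, u i * duj i) - (θ * (Zη + η * Z'η) * dρ + ρ * Zη * dθ))
    (hρpos : 0 < ρ) (hρlo : M⁻¹ ≤ ρ) (hθpos : 0 < θ) (hθhi : θ ≤ M) (hM : 0 < M)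
    (hZη : |Zη| ≤ CZ) (hZ'η : |Z'η| ≤ CZ) (hCZ : 0 ≤ CZ) (hη : 0 ≤ η) (hηT : η ≤ ηT) (hηT0 : 0 ≤ ηT)
    (hu : ∀ i, |u i| ≤ M) (hduj : ∀ i, |duj i| ≤ A) (hdρ : |dρ| ≤ A) (hdθ : |dθ| ≤ A)
    (hA : 0 ≤ A) : |X| ≤ (3 * M + M * M * (CZ * (1 + ηT)) + CZ) * A := by
  have hadv : |∑ i, u i * duj i| ≤ 3 * M * A := by
    refine (Finset.abs_sum_le_sum_abs _ _).trans ?_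
    calc ∑ i, |u i * duj i| ≤ ∑ _i : Fin 3, M * A := Finset.sum_le_sum fun i _ => by
            rw [abs_mul]; exact mul_le_mul (hu i) (hduj i) (abs_nonneg _) hM.le
      _ = 3 * M * A := by rw [sum_const_fin_three]; ring
  have hco : |Zη + η * Z'η| ≤ CZ * (1 + ηT) := by
    refine (abs_add_le _ _).trans ?_
    rw [abs_mul, abs_of_nonneg hη]
    have h := mul_le_mul hηT hZ'η (abs_nonneg _) hηT0
    linarith
  have hpr : |θ * (Zη + η * Z'η) * dρ + ρ * Zη * dθ| ≤ M * (CZ * (1 + ηT)) * A + ρ * CZ * A := by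
    refine (abs_add_le _ _).trans (add_le_add ?_ ?_)
    · rw [abs_mul, abs_mul, abs_of_pos hθpos]
      exact mul_le_mul (mul_le_mul hθhi hco (abs_nonneg _) hM.le) hdρ (abs_nonneg _)
        (by positivity)
    · rw [abs_mul, abs_mul, abs_of_pos hρpos]
      exact mul_le_mul (mul_le_mul_of_nonneg_left hZη hρpos.le) hdθ (abs_nonneg _) (by positivity)
  have h1 : |ρ * X| ≤ ρ * (3 * M * A) + (M * (CZ * (1 + ηT)) * A + ρ * CZ * A) := by
    rw [hX]
    refine (abs_sub _ _).trans (add_le_add ?_ hpr)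
    rw [abs_neg, abs_mul, abs_of_pos hρpos]
    exact mul_le_mul_of_nonneg_left hadv hρpos.le
  rw [abs_mul, abs_of_pos hρpos] at h1
  have hρM : 1 ≤ ρ * M := by
    have h := mul_le_mul_of_nonneg_right hρlo hM.le
    rwa [inv_mul_cancel₀ hM.ne'] at h
  have h2 : M * (CZ * (1 + ηT)) * A ≤ ρ * (M * M * (CZ * (1 + ηT))) * A := by
    have hc : 0 ≤ M * (CZ * (1 + ηT)) * A := by positivity
    calc M * (CZ * (1 + ηT)) * A = M * (CZ * (1 + ηT)) * A * 1 := by ring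
      _ ≤ M * (CZ * (1 + ηT)) * A * (ρ * M) := mul_le_mul_of_nonneg_left hρM hc
      _ = ρ * (M * M * (CZ * (1 + ηT))) * A := by ring
  have hkey : ρ * |X| ≤ ρ * ((3 * M + M * M * (CZ * (1 + ηT)) + CZ) * A) := by
    calc ρ * |X| ≤ ρ * (3 * M * A) + (M * (CZ * (1 + ηT)) * A + ρ * CZ * A) := h1
      _ ≤ ρ * (3 * M * A) + (ρ * (M * M * (CZ * (1 + ηT))) * A + ρ * CZ * A) := by linarith
      _ = ρ * ((3 * M + M * M * (CZ * (1 + ηT)) + CZ) * A) := by ring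
  exact le_of_mul_le_mul_left hkey hρpos

/-- Read-out of the temperature equation `∂ₜθ = -Σᵢ uᵢ ∂ᵢθ - (2/3) θ Z Σᵢ ∂ᵢuᵢ`:
`|∂ₜθ| ≤ (3M + 2 M C_Z) A`. [folklore] -/
private theorem temperature_readout {θ Zη M CZ A X : ℝ} {u dθ ddiv : Fin 3 → ℝ}
    (hX : X = -(∑ i, u i * dθ i) - 2 / 3 * (θ * Zη) * ∑ i, ddiv i)
    (hθpos : 0 < θ) (hθhi : θ ≤ M) (hM : 0 < M) (hZη : |Zη| ≤ CZ) (hu : ∀ i, |u i| ≤ M)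
    (hdθ : ∀ i, |dθ i| ≤ A) (hddiv : ∀ i, |ddiv i| ≤ A) :
    |X| ≤ (3 * M + 2 * M * CZ) * A := by
  have hadv : |∑ i, u i * dθ i| ≤ 3 * M * A := by
    refine (Finset.abs_sum_le_sum_abs _ _).trans ?_
    calc ∑ i, |u i * dθ i| ≤ ∑ _i : Fin 3, M * A := Finset.sum_le_sum fun i _ => by
            rw [abs_mul]; exact mul_le_mul (hu i) (hdθ i) (abs_nonneg _) hM.le
      _ = 3 * M * A := by rw [sum_const_fin_three]; ring
  have hdiv : |∑ i, ddiv i| ≤ 3 * A := by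
    refine (Finset.abs_sum_le_sum_abs _ _).trans ?_
    calc ∑ i, |ddiv i| ≤ ∑ _i : Fin 3, A := Finset.sum_le_sum fun i _ => hddiv i
      _ = 3 * A := sum_const_fin_three A
  have hCZ : 0 ≤ CZ := (abs_nonneg _).trans hZη
  have h2 : |2 / 3 * (θ * Zη) * ∑ i, ddiv i| ≤ 2 / 3 * (M * CZ) * (3 * A) := by
    rw [abs_mul, abs_mul, abs_of_pos (by norm_num : (0 : ℝ) < 2 / 3), abs_mul, abs_of_pos hθpos]
    exact mul_le_mul (mul_le_mul_of_nonneg_left (mul_le_mul hθhi hZη (abs_nonneg _) hM.le)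
      (by norm_num)) hdiv (abs_nonneg _) (by positivity)
  rw [hX]
  calc |-(∑ i, u i * dθ i) - 2 / 3 * (θ * Zη) * ∑ i, ddiv i|
      ≤ |-(∑ i, u i * dθ i)| + |2 / 3 * (θ * Zη) * ∑ i, ddiv i| := abs_sub _ _
    _ ≤ 3 * M * A + 2 / 3 * (M * CZ) * (3 * A) := by rw [abs_neg]; exact add_le_add hadv h2
    _ = (3 * M + 2 * M * CZ) * A := by ring

/-- **Drift bound** (vector-valued). A jointly smooth field on `[0, T) × 𝕋³` whose one-sided time
derivative is bounded in norm by `R` on `[0, t)` moves by at most `R t` between times `0` and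
`t < T` (mean value inequality along the time slice). [folklore] -/
-- adapted from `Literature.Analysis.FluidPDE.CompressibleEuler.abs_sub_le_of_timeDerivWithin_le`
theorem norm_sub_le_of_timeDerivWithin_le {F : Type*} [NormedAddCommGroup F] [NormedSpace ℝ F]
    {w : ℝ → T3 → F} {T t R : ℝ} (hw : Torus.IsSmoothSpaceTimeOn (Ico 0 T) w) (ht : t ∈ Ico 0 T)
    (x : T3) (hR : ∀ s ∈ Ico 0 t, ‖Torus.timeDerivWithin (Ico 0 T) w s x‖ ≤ R) :
    ‖w t x - w 0 x‖ ≤ R * t := by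
  have hsub : Icc 0 t ⊆ Ico 0 T := fun s hs => ⟨hs.1, hs.2.trans_lt ht.2⟩
  have hder : ∀ s ∈ Icc 0 t, HasDerivWithinAt (fun τ => w τ x)
      (Torus.timeDerivWithin (Ico 0 T) w s x) (Icc 0 t) s :=
    fun s hs => (hw.hasDerivWithinAt_slice (hsub hs) x).mono hsub
  have h := norm_image_sub_le_of_norm_deriv_le_segment' hder hR t ⟨ht.1, le_rfl⟩
  rwa [sub_zero] at h

/-- **σ-uniform read-outs of the primitive hard-sphere Euler equations: time-derivative and drift
bounds, linear in the `C¹` size.** There are a packing threshold `ηT > 0` and, for every guard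
level `M > 0`, a constant `CT = CT(M) > 0` — depending on `M` and on the analytic low-density
equation of state only, NOT on the reduced diameter `σ`, the horizon or the solution — such that
for every classical hard-sphere Euler solution `(ρ, u, θ)` at reduced diameter `σ > 0` on `[0, T)`:
(1) at every `(t, x)`, `t ∈ [0, T)`, at which the packing is `≤ ηT` everywhere at time `t` and the
state obeys `M⁻¹ ≤ ρ ≤ M`, `θ ≤ M`, `‖u‖ ≤ M` at `x`, first spatial derivatives bounded by `A` at
`x` give `|∂ₜρ|, ‖∂ₜu‖, |∂ₜθ| ≤ CT · A` at `(t, x)` (every term of the primitive equations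
`∂ₜρ = -u·∇ρ - ρ div u`, `∂ₜu = -(u·∇)u - (p_ρ ∇ρ + p_θ ∇θ)/ρ`,
`∂ₜθ = -u·∇θ - (2/3) θ Z(ρσ³) div u`, `p = ρ θ Z(ρσ³)`, carries exactly one first derivative,
with a coefficient bounded in terms of
`M` and `sup_{[0, ηT]} (|Z| + |Z'|)`); (2) consequently, if these hypotheses hold everywhere on
the slab `[0, t) × 𝕋³`, the fields drift by at most `CT · A · t` between times `0` and `t`
(mean value inequality). [folklore] -/
theorem hsEuler_timeDeriv_drift_bounds :
    ∃ ηT : ℝ, 0 < ηT ∧ ∀ M : ℝ, 0 < M → ∃ CT : ℝ, 0 < CT ∧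
      ∀ (σ T : ℝ) (ρ θ : ℝ → T3 → ℝ) (u : ℝ → T3 → V3), 0 < σ →
        IsHardSphereEulerSolution σ T ρ u θ →
        (∀ t ∈ Set.Ico 0 T, (∀ y, ρ t y * σ ^ 3 ≤ ηT) → ∀ (x : T3) (A : ℝ),
            M⁻¹ ≤ ρ t x → ρ t x ≤ M → θ t x ≤ M → ‖u t x‖ ≤ M →
            (∀ i : Fin 3, |Torus.partialDeriv i (ρ t) x| ≤ A ∧
              ‖Torus.partialDeriv i (u t) x‖ ≤ A ∧ |Torus.partialDeriv i (θ t) x| ≤ A) →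
            |Torus.timeDerivWithin (Set.Ico 0 T) ρ t x| ≤ CT * A ∧
              ‖Torus.timeDerivWithin (Set.Ico 0 T) u t x‖ ≤ CT * A ∧
                |Torus.timeDerivWithin (Set.Ico 0 T) θ t x| ≤ CT * A) ∧
        (∀ t ∈ Set.Ico 0 T, ∀ A : ℝ,
            (∀ s ∈ Set.Ico 0 t, ∀ y, ρ s y * σ ^ 3 ≤ ηT ∧ M⁻¹ ≤ ρ s y ∧ ρ s y ≤ M ∧ θ s y ≤ M ∧
              ‖u s y‖ ≤ M ∧ ∀ i : Fin 3, |Torus.partialDeriv i (ρ s) y| ≤ A ∧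
                ‖Torus.partialDeriv i (u s) y‖ ≤ A ∧ |Torus.partialDeriv i (θ s) y| ≤ A) →
            ∀ x : T3, |ρ t x - ρ 0 x| ≤ CT * A * t ∧ ‖u t x - u 0 x‖ ≤ CT * A * t ∧
              |θ t x - θ 0 x| ≤ CT * A * t) := by
  obtain ⟨η₀, hη₀, F, hFa, hEq, -, -, -⟩ := hsEosLowDensity_proof
  obtain ⟨Z, hZ, hZeq⟩ := exists_contDiff_eqOn_hsCompressibility hη₀ hFa hEq
  -- bounds for `Z` and `Z'` on the packing range `[0, η₀/4]`
  have hK : IsCompact (Icc (0 : ℝ) (η₀ / 4)) := isCompact_Icc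
  obtain ⟨C₁, hC₁⟩ := hK.exists_bound_of_continuousOn hZ.continuous.continuousOn
  obtain ⟨C₂, hC₂⟩ := hK.exists_bound_of_continuousOn (hZ.continuous_deriv (by simp)).continuousOn
  set CZ : ℝ := max (max C₁ C₂) 0 with hCZ
  have hCZ0 : 0 ≤ CZ := le_max_right _ _
  have hZb : ∀ η ∈ Icc (0 : ℝ) (η₀ / 4), |Z η| ≤ CZ := fun η hη =>
    (Real.norm_eq_abs _ ▸ hC₁ η hη).trans ((le_max_left _ _).trans (le_max_left _ _))
  have hZ'b : ∀ η ∈ Icc (0 : ℝ) (η₀ / 4), |deriv Z η| ≤ CZ := fun η hη =>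
    (Real.norm_eq_abs _ ▸ hC₂ η hη).trans ((le_max_right _ _).trans (le_max_left _ _))
  have hηT0 : (0 : ℝ) ≤ η₀ / 4 := by positivity
  refine ⟨η₀ / 4, by positivity, fun M hM => ?_⟩
  set Cu : ℝ := 3 * M + M * M * (CZ * (1 + η₀ / 4)) + CZ with hCu
  have hCu0 : 0 ≤ Cu := by positivity
  have hCθ0 : 0 ≤ 3 * M + 2 * M * CZ := by positivity
  set CT : ℝ := 6 * M + 3 * Cu + (3 * M + 2 * M * CZ) + 1 with hCT
  have hCT1 : 6 * M ≤ CT := by rw [hCT]; linarith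
  have hCT2 : 3 * Cu ≤ CT := by rw [hCT]; linarith
  have hCT3 : 3 * M + 2 * M * CZ ≤ CT := by rw [hCT]; linarith
  refine ⟨CT, by positivity, ?_⟩
  intro σ T ρ θ u hσ hE
  have hσ3 : (0 : ℝ) < σ ^ 3 := pow_pos hσ 3
  have hU : UniqueDiffOn ℝ (Ico (0 : ℝ) T) := uniqueDiffOn_Ico 0 T
  -- (T1) pointwise time-derivative bounds
  have T1 : ∀ t ∈ Set.Ico 0 T, (∀ y, ρ t y * σ ^ 3 ≤ η₀ / 4) → ∀ (x : T3) (A : ℝ),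
      M⁻¹ ≤ ρ t x → ρ t x ≤ M → θ t x ≤ M → ‖u t x‖ ≤ M →
      (∀ i : Fin 3, |Torus.partialDeriv i (ρ t) x| ≤ A ∧
        ‖Torus.partialDeriv i (u t) x‖ ≤ A ∧ |Torus.partialDeriv i (θ t) x| ≤ A) →
      |Torus.timeDerivWithin (Set.Ico 0 T) ρ t x| ≤ CT * A ∧
        ‖Torus.timeDerivWithin (Set.Ico 0 T) u t x‖ ≤ CT * A ∧
          |Torus.timeDerivWithin (Set.Ico 0 T) θ t x| ≤ CT * A := by
    intro t ht hpack x A hρlo hρhi hθhi hux hA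
    have hA0 : 0 ≤ A := (abs_nonneg _).trans (hA 0).1
    have hρpos : 0 < ρ t x := hE.density_pos t ht x
    have hθpos : 0 < θ t x := hE.temperature_pos t ht x
    have hη : ρ t x * σ ^ 3 ∈ Icc (0 : ℝ) (η₀ / 4) := ⟨by positivity, hpack x⟩
    have hu1 : Torus.IsContDiff 1 (u t) :=
      (hE.smooth_velocity.isSmooth_slice ht).isContDiff (by simp)
    have hui : ∀ i, |u t x i| ≤ M := fun i => (abs_apply_le_norm' _ i).trans hux
    have hdu : ∀ i j, |Torus.partialDeriv i (fun y => u t y j) x| ≤ A := fun i j => by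
      rw [Torus.partialDeriv_apply_coord hu1 i x j]
      exact (abs_apply_le_norm' _ j).trans (hA i).2.1
    obtain ⟨hPu, hPθ⟩ := primitive_of_packing_at hη₀ hZ hZeq hσ hE ht hpack x
    have hBρ : |Torus.timeDerivWithin (Ico 0 T) ρ t x| ≤ 6 * M * A :=
      density_readout (u := fun i => u t x i)
        (du := fun i => Torus.partialDeriv i (fun y => u t y i) x)
        (dρ := fun i => Torus.partialDeriv i (ρ t) x) (hE.timeDeriv_density_eq ht x) hρpos hρhi hM
        hui (fun i => hdu i i) (fun i => (hA i).1) hA0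
    have hBuj : ∀ j, |Torus.timeDerivWithin (Ico 0 T) (fun s y => u s y j) t x| ≤ Cu * A :=
      fun j => velocity_coord_readout (u := fun i => u t x i)
        (duj := fun i => Torus.partialDeriv i (fun y => u t y j) x) (hPu j) hρpos hρlo hθpos hθhi
        hM (hZb _ hη) (hZ'b _ hη) hCZ0 hη.1 hη.2 hηT0 hui (fun i => hdu i j) (hA j).1 (hA j).2.2 hA0
    have hBu : ‖Torus.timeDerivWithin (Ico 0 T) u t x‖ ≤ 3 * Cu * A := by
      calc ‖Torus.timeDerivWithin (Ico 0 T) u t x‖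
          ≤ ∑ j, |Torus.timeDerivWithin (Ico 0 T) u t x j| := norm_le_sum_abs' _
        _ = ∑ j, |Torus.timeDerivWithin (Ico 0 T) (fun s y => u s y j) t x| :=
            Finset.sum_congr rfl fun j _ => by
              rw [HsEulerCalc.timeDerivWithin_apply_coord hE.smooth_velocity hU ht x j]
        _ ≤ ∑ _j : Fin 3, Cu * A := Finset.sum_le_sum fun j _ => hBuj j
        _ = 3 * Cu * A := by rw [sum_const_fin_three]; ring
    have hBθ : |Torus.timeDerivWithin (Ico 0 T) θ t x| ≤ (3 * M + 2 * M * CZ) * A :=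
      temperature_readout (u := fun i => u t x i) (dθ := fun i => Torus.partialDeriv i (θ t) x)
        (ddiv := fun i => Torus.partialDeriv i (fun y => u t y i) x) hPθ hθpos hθhi hM (hZb _ hη)
        hui (fun i => (hA i).2.2) fun i => hdu i i
    exact ⟨hBρ.trans (mul_le_mul_of_nonneg_right hCT1 hA0),
      hBu.trans (mul_le_mul_of_nonneg_right hCT2 hA0),
      hBθ.trans (mul_le_mul_of_nonneg_right hCT3 hA0)⟩
  -- (T2) drift on a slab
  refine ⟨T1, fun t ht A hslab x => ?_⟩
  have hR : ∀ s ∈ Ico 0 t, |Torus.timeDerivWithin (Set.Ico 0 T) ρ s x| ≤ CT * A ∧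
      ‖Torus.timeDerivWithin (Set.Ico 0 T) u s x‖ ≤ CT * A ∧
        |Torus.timeDerivWithin (Set.Ico 0 T) θ s x| ≤ CT * A := fun s hs => by
    have hsT : s ∈ Ico 0 T := ⟨hs.1, hs.2.trans ht.2⟩
    obtain ⟨-, g2, g3, g4, g5, g6⟩ := hslab s hs x
    exact T1 s hsT (fun y => (hslab s hs y).1) x A g2 g3 g4 g5 g6
  refine ⟨?_, norm_sub_le_of_timeDerivWithin_le hE.smooth_velocity ht x fun s hs => (hR s hs).2.1,
    ?_⟩
  · have h := norm_sub_le_of_timeDerivWithin_le hE.smooth_density ht x fun s hs => by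
      rw [Real.norm_eq_abs]; exact (hR s hs).1
    rwa [Real.norm_eq_abs] at h
  · have h := norm_sub_le_of_timeDerivWithin_le hE.smooth_temperature ht x fun s hs => by
      rw [Real.norm_eq_abs]; exact (hR s hs).2.2
    rwa [Real.norm_eq_abs] at h

end Summit.AtomisticToContinuum.HydrodynamicLimit.Theorems.ConeLocalisation.Bubble

end
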